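import Summits.QuantumFields.YangMills.Theorems.BalabanUVNodesN16HolderMSOfLeafL1
import Literature.MathematicalPhysics.QuantumFieldTheory.Balaban1983to89.B8LeafModelZd3SourceReality
import Literature.MathematicalPhysics.QuantumFieldTheory.Balaban1983to89.B8LeafKnit
import HarnessLib

/-!
# Route «BalabanUVNodes» (K3⁗ `SpineGivenEndpointR13Sep`), DAG node N16 = NE3 — THE N05 → N16 EDGE RE-CUT AT THE TWO PRINTED SENTENCES N16 READS
# ([Balaban1985RegularSpaces] Thm 4 p. 88 = `B8.Thm4Printed`, Prop 3 p. 87 = `B8.Prop3Printed` on n05-a's family `zdGF3 (M_n ℂ) L β len` over the univ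
# sub-index), AFTER n05-c's certificate that the leaf-of-record SHAPE `B8LeafKnitRS.B8LeafRS` is UNINHABITED on that family (p501857)

Cell `pub-ymgap`, seat `pub-ymgap-dag-n16-c` (R134 fan-out seat, strategy s1; HUMAN RULING D-0062; chair R424 venue), generation 5, file 40 — over
generation 0's files 5 ∕ 6 (`N16.OfLeaf.n16_of_leaf`, `N16.OfLeafRS.n16_of_b8LeafRS`), generation 4's files 36 ∕ 38 (`N16HolderMSOfLeafTop.n16_holderMS_of_leaf`,
`N16HolderMSOfLeafL1`) and n05-c's `B8LeafModelZd3SourceReality` (p501857).  `--supports stmt-QuantumFields-20292 --as helper` (K3⁗, dag-lead WORDS-140).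
`bears_on: R4∕N16 · edge N05 → N16`.

WHY.  Six ★ theorems of this lineage state «N16 from node N05's LEAF OF RECORD SHAPE»: one hypothesis `B8LeafRS 4 L C₂ B₁′ B₀′ B₁ B₂ c₁ inp B₀β loc
(fun i : {i : ZdIdx 4 L // i.Ω 0 = univ} ↦ zdGF3 (M_n ℂ) L β len i.1) lan cub toAxial` (g0 `n16_of_b8LeafRS`, g3 `n16_holder_of_b8LeafRS` ∕
`leafSlotHolder_of_b8LeafRS` ∕ `ne3Shape_of_b8LeafRS_holder`, g4 `n16_holderMS_of_b8LeafRS` ∕ `n16_holderMS_of_b8LeafRS_l1Len`), of which only the fields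
`t4 : B8.Thm4Printed …` and `p3 : B8.Prop3Printed …` are read.  n05-c's `B8LeafModelZd3SourceReality.not_thm8SurvivingAt_zdGF3_univ` (p501857) proves the
field `t8 := Thm8SurvivingAt 1 B₁ B₂ fam` FALSE on exactly this family for every `L ≥ 2` (the typed source space of `zdGF3` forgets print's «Lie algebra
valued», Thm 8 p. 101): so that hypothesis is UNINHABITED and the six ★s — all stated under `2 ≤ L` — are VACUOUS as stated (valid kernel theorems with
jointly unsatisfiable hypotheses).  THIS FILE (§1) records that certificate at the N16 face, and (§3) RE-CUTS the N05-socket at the two printed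
sentences N16 actually consumes — [Balaban1985RegularSpaces] Theorem 4 (p. 88) and Proposition 3 (p. 87) AS TYPED (`B8.Thm4Printed B₁′ fam = ∃ c₁ > 0,
Thm4Body c₁ B₁′ fam`, `B8.Prop3Printed 4 L C₂ inp B₀β fam₂ = ∃ cP > 0, Prop3Body …`), which do not read the source space and are untouched by p501857 —
with the conclusions of the ★s VERBATIM.  §2 supplies the restriction faces from n05-a's ALL-index instances `B8LeafModelZd3.thm4Printed_zd3` ∕
`prop3Printed_zd3` (Theorem 4 ∕ Proposition 3 on `zdGF3`, modulo n05-a's un-sourced sockets `SockP5base ∕ SockP5 ∕ SockH59 ∕ SockP5u ∕ SockB9P3`) to the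
univ sub-family, so the edge keys BY NAME on node N05's Theorem-4 ∕ Proposition-3 theorems.

WHAT THIS FILE PROVES (kernel, theorems only, 0 `def`, 0 sorry):
* §1 `not_b8LeafRS_zdGF3_univ` (any `d ≥ 2`, `L ≥ 2`, nontrivial C⋆-algebra `𝔸`, all leaf letters and carriers: the leaf-of-record SHAPE on the univ
  sub-family of `zdGF3 𝔸 L β len` is FALSE), `not_b8LeafRS_zdGF3_univ_matrix` (its `M_n(ℂ)`, `d = 4` instance = the hypothesis of the six ★s verbatim).
* §2 `thm4Printed_univ_of_zd3`, `prop3Printed_univ_of_zd3` (ALL-index ⟹ univ sub-index; `B8LeafKnit.thm4Printed_precomp` ∕ `prop3Printed_precomp`).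
* §3 `n16_of_leafTP` (β = 1: `… → NE3EnergyRateWCov 4 (sfClass 4 L N ε) L N b g C s₁ s₂ dom`, the root of record), `n16_holderMS_of_leafTP` (R-β″: any
  `β ∈ [0,1]`, `… → CovRootHolderMS 4 (sfClass 4 L N ε) L N b g C s₁ s₂ β dom`), `n16_holderMS_of_leafTP_l1Len` (the same at print's ℓ¹ length
  `B9Eq340HolderZd.l1Len`, both length letters discharged).

HONEST FRAMING: bookkeeping by name plus one negative certificate imported from n05-c; nothing of Bałaban is proved here; the hypotheses
`Thm4Printed` ∕ `Prop3Printed` on `zdGF3` at curved backgrounds are node N05's theorems ([Balaban1985RegularSpaces] Thm 4 ∕ Prop 3 on the `ℤ⁴` carriers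
— in the tree only modulo n05-a's sockets), (H3ˢᵘᵖ) = N07's [Balaban1985Variational] Thm 1 TYPE; N16 ∕ NE3 NOT discharged; count-neutral; one finite
four-torus at fixed ε — NOT ℝ⁴, NOT infinite volume, NOT OS, NOT a mass gap, NOT Clay.
-/

set_option autoImplicit false

open scoped BigOperators Matrix Matrix.Norms.L2Operator
open NormedSpace

namespace Summit.QuantumFields.YangMills.BalabanUVNodes.N16OfLeafTP

open Literature.MathematicalPhysics.QuantumFieldTheory.Balaban1983to89
open B7Prop1Explicit B7Prop2Explicit
open B7Prop3Flat (c3)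
open B8LeafModelZd (ZdIdx)
open B8LeafModelZd3 (zdGF3)
open B8LeafKnitRS (B8LeafRS)
open Summit.QuantumFields.BalabanUV.T4Continuum
open BlockAverageCurrent (curConst)
open NE3EnergyWeightedCovShape (NE3EnergyRateWCov)
open NE3RightInverseSupLetters (frameC)
open NE3.LeafIndexSockets (LeafH3sup)
open MinimalActionRate (sfClass)
open Summit.QuantumFields.YangMills.BalabanUVNodes.N16HolderMSDefs (CovRootHolderMS)
open Summit.QuantumFields.YangMills.BalabanUVNodes.N16.OfLeaf (exists_window_print n16_of_leaf)
open Summit.QuantumFields.YangMills.BalabanUVNodes.N16HolderMSOfLeafTop (n16_holderMS_of_leaf)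
open Summit.QuantumFields.YangMills.BalabanUVNodes.N16HolderMSOfLeafL1 (l1Len_nsmul_e)
open B9Eq340HolderZd (l1Len one_le_l1Len)

noncomputable section

/-! ## §1 The leaf-of-record SHAPE is uninhabited on the univ sub-family of `zdGF3` (n05-c's certificate at the N16 face) -/

section Vacuity

variable {d : ℕ} {𝔸 : Type} [CStarAlgebra 𝔸] [Nontrivial 𝔸]

/-- **THE LEAF-OF-RECORD SHAPE IS FALSE ON THE UNIV SUB-FAMILY OF `zdGF3`** (`d ≥ 2`, `L ≥ 2`; every Hölder datum `β, len`, every leaf letter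
`Lr C₂ B₁′ B₀′ B₁ B₂ c₁ inp B₀β`, all carriers `loc lan cub toAxial`): the conjunct `t8 := Thm8SurvivingAt 1 B₁ B₂ fam` of `B8LeafKnitRS.B8LeafRS` contradicts
n05-c's `B8LeafModelZd3SourceReality.not_thm8SurvivingAt_zdGF3_univ` at `γ = 1` (the typed source space `Src := Site d → 𝔸` of `zdGF3` forgets print's
«Lie algebra valued»; the imaginary dipole source admits no solution of (1.146) with a unitary gauge transformation).  Nothing printed is refuted: the
typed sentence is stronger than [Balaban1985RegularSpaces] Theorem 8. [cite: Balaban1985RegularSpaces, Thm 8 (1.146) p.101 («Lie algebra valued»), p.77 («Ω_j = T_η»)] -/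
theorem not_b8LeafRS_zdGF3_univ (hd2 : 2 ≤ d) {L : ℕ} (hL : 2 ≤ L) (β : ℝ) (len : Site d → ℝ)
    {I₁ I₃ I₄ : Type} (Lr C₂ B₁' B₀' B₁ B₂ c₁ : ℝ) (inp : B8.B9Inputs) (B₀β : ℝ) (loc : I₁ → B8.LocalData)
    (lan : I₃ → B8.LandauData) (cub : I₄ → B8.CubeData)
    (toAxial : ∀ i : {i : ZdIdx d L // i.Ω 0 = Set.univ},
      (zdGF3 𝔸 L β len i.1).Cfg → (zdGF3 𝔸 L β len i.1).Pert → (zdGF3 𝔸 L β len i.1).Pert) :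
    ¬ B8LeafRS d Lr C₂ B₁' B₀' B₁ B₂ c₁ inp B₀β loc
        (fun i : {i : ZdIdx d L // i.Ω 0 = Set.univ} => zdGF3 𝔸 L β len i.1) lan cub toAxial := fun h =>
  B8LeafModelZd3SourceReality.not_thm8SurvivingAt_zdGF3_univ hd2 hL β len one_pos B₁ B₂ h.t8

end Vacuity

section VacuityMatrix

variable {n : Type} [Fintype n] [DecidableEq n]

/-- **THE HYPOTHESIS OF THIS LINEAGE's SIX «LEAF OF RECORD SHAPE» ★s IS UNINHABITED** (`d = 4`, `𝔸 = M_n(ℂ)` with the `L²`-operator-norm C⋆-structure,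
`n` nonempty, `L ≥ 2`): `¬ B8LeafRS 4 Lr C₂ B₁′ B₀′ B₁ B₂ c₁ inp B₀β loc (fun i : {i // i.Ω 0 = univ} ↦ zdGF3 (M_n ℂ) L β len i.1) lan cub toAxial` for every
`β, len` and all letters ∕ carriers — so g0's `N16.OfLeafRS.n16_of_b8LeafRS`, g3's `N16HolderOfLeaf.n16_holder_of_b8LeafRS` ∕
`N16HolderLeafSlot.leafSlotHolder_of_b8LeafRS` ∕ `N16HolderShapeOfLeaf.ne3Shape_of_b8LeafRS_holder` and g4's `N16HolderMSOfLeafTop.n16_holderMS_of_b8LeafRS` ∕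
`N16HolderMSOfLeafL1.n16_holderMS_of_b8LeafRS_l1Len` (all under `2 ≤ L`) are VACUOUS as stated; their un-vacated content is §3 below.
[cite: Balaban1985RegularSpaces, Thm 8 (1.146) p.101 («Lie algebra valued»)] -/
theorem not_b8LeafRS_zdGF3_univ_matrix [Nonempty n] {L : ℕ} (hL : 2 ≤ L) :
    letI : CStarAlgebra (Matrix n n ℂ) := {}
    ∀ {I₁ I₃ I₄ : Type} (β : ℝ) (len : Site 4 → ℝ) (Lr C₂ B₁' B₀' B₁ B₂ c₁ : ℝ) (inp : B8.B9Inputs) (B₀β : ℝ) (loc : I₁ → B8.LocalData)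
      (lan : I₃ → B8.LandauData) (cub : I₄ → B8.CubeData)
      (toAxial : ∀ i : {i : ZdIdx 4 L // i.Ω 0 = Set.univ},
        (zdGF3 (Matrix n n ℂ) L β len i.1).Cfg → (zdGF3 (Matrix n n ℂ) L β len i.1).Pert → (zdGF3 (Matrix n n ℂ) L β len i.1).Pert),
      ¬ B8LeafRS 4 Lr C₂ B₁' B₀' B₁ B₂ c₁ inp B₀β loc
          (fun i : {i : ZdIdx 4 L // i.Ω 0 = Set.univ} => zdGF3 (Matrix n n ℂ) L β len i.1) lan cub toAxial := by
  letI : CStarAlgebra (Matrix n n ℂ) := {}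
  intro I₁ I₃ I₄ β len Lr C₂ B₁' B₀' B₁ B₂ c₁ inp B₀β loc lan cub toAxial
  exact not_b8LeafRS_zdGF3_univ (by norm_num) hL β len Lr C₂ B₁' B₀' B₁ B₂ c₁ inp B₀β loc lan cub toAxial

end VacuityMatrix

/-! ## §2 Restriction faces: n05-a's ALL-index Theorem 4 ∕ Proposition 3 on `zdGF3` ⟹ the univ sub-family -/

section Restrict

variable {d : ℕ} {𝔸 : Type} [CStarAlgebra 𝔸]

/-- **Theorem 4 on all of n05-a's index `ZdIdx d L` gives it on the univ sub-index** (same `B₁′`, same threshold) — what `B8LeafModelZd3.thm4Printed_zd3`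
(modulo its sockets) delivers, restricted by `B8LeafKnit.thm4Printed_precomp`.  Pure logic. [cite: Balaban1985RegularSpaces, Thm 4 p.88 (bookkeeping: restriction of the family index)] -/
theorem thm4Printed_univ_of_zd3 {L : ℕ} {β : ℝ} {len : Site d → ℝ} {B₁' : ℝ}
    (h : B8.Thm4Printed B₁' (fun i : ZdIdx d L => (zdGF3 𝔸 L β len i).toGFData)) :
    B8.Thm4Printed B₁' (fun i : {i : ZdIdx d L // i.Ω 0 = Set.univ} => (zdGF3 𝔸 L β len i.1).toGFData) :=
  B8LeafKnit.thm4Printed_precomp (fun i : {i : ZdIdx d L // i.Ω 0 = Set.univ} => i.1) B₁'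
    (fun i : ZdIdx d L => (zdGF3 𝔸 L β len i).toGFData) h

/-- **Proposition 3 on all of n05-a's index `ZdIdx d L` gives it on the univ sub-index** (same letters, same threshold) — what
`B8LeafModelZd3.prop3Printed_zd3` (modulo its socket `SockB9P3`) delivers, restricted by `B8LeafKnit.prop3Printed_precomp`.  Pure logic.
[cite: Balaban1985RegularSpaces, Prop. 3 p.87 (bookkeeping: restriction of the family index)] -/
theorem prop3Printed_univ_of_zd3 {L : ℕ} {β : ℝ} {len : Site d → ℝ} {Lr C₂ B₀β : ℝ} {inp : B8.B9Inputs}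
    (h : B8.Prop3Printed d Lr C₂ inp B₀β (fun i : ZdIdx d L => (zdGF3 𝔸 L β len i).toGFData2)) :
    B8.Prop3Printed d Lr C₂ inp B₀β (fun i : {i : ZdIdx d L // i.Ω 0 = Set.univ} => (zdGF3 𝔸 L β len i.1).toGFData2) :=
  B8LeafKnit.prop3Printed_precomp (fun i : {i : ZdIdx d L // i.Ω 0 = Set.univ} => i.1) d Lr C₂ inp B₀β
    (fun i : ZdIdx d L => (zdGF3 𝔸 L β len i).toGFData2) h

end Restrict

/-! ## §3 The N05-socket re-cut at Theorem 4 ∕ Proposition 3 as typed: β = 1 (root of record) and R-β″ (multi-scale β-root) -/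

section Matrices

variable {n : Type} [Fintype n] [DecidableEq n]

/-- **N16 · NE3 FROM NODE N05's THEOREM 4 AND PROPOSITION 3 ON `zdGF3 (M_n(ℂ)) L 1 len` OVER THE UNIV SUB-INDEX, AND N07's (H3ˢᵘᵖ)** (`d = 4`, `L ≥ 2`,
`N ≥ 1`, `β₀ = 1`) — generation 0's `N16.OfLeafRS.n16_of_b8LeafRS` with its ONE (uninhabited, §1) hypothesis `B8LeafRS …` REPLACED by the two fields it
read: `B8.Thm4Printed B₁′ fam` ([Balaban1985RegularSpaces] Thm 4 p. 88 as typed) and `B8.Prop3Printed 4 L C₂ inp B₀β fam₂` (Prop 3 p. 87), `fam := fun i :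
{i : ZdIdx 4 L // i.Ω 0 = univ} ↦ zdGF3 (M_n ℂ) L 1 len i.1`.  Conclusion VERBATIM: a window threshold `c₁′ > 0` with `16·(5·4·L·B₀)·c₁′ ≤ 1` (g0's
`exists_window_print`) and file 5 §3's tail, ending in `LeafH3sup 4 L N ε b′ c′ dom → NE3EnergyRateWCov 4 (sfClass 4 L N ε) L N b g C s₁ s₂ dom`.
N16 ∕ NE3 NOT proved: Theorem 4 ∕ Proposition 3 on the `ℤ⁴` carriers are node N05's theorems, (H3ˢᵘᵖ) is N07's.
[cite: Balaban1985RegularSpaces, Thm 4 p.88, Prop. 3 p.87] [folklore] -/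
theorem n16_of_leafTP [Nonempty n] {L N : ℕ} (hL : 2 ≤ L) (hN : 1 ≤ N) :
    letI : CStarAlgebra (Matrix n n ℂ) := {}
    ∃ r : ℝ, 0 < r ∧ ∀ ⦃g : ℝ⦄, 0 < g → ∃ C : ℝ, 0 ≤ C ∧
      ∀ (C₂ B₁' : ℝ) (inp : B8.B9Inputs) (B₀β : ℝ) (len : Site 4 → ℝ),
      (∀ v : Site 4, 0 < len v → 1 ≤ len v) → (∀ μ : Fin 4, len (e μ) = 1) → 0 < B₁' → 5 * ((4 : ℕ) : ℝ) * L * inp.B₀ ≤ B₁' →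
      B8.Thm4Printed B₁' (fun i : {i : ZdIdx 4 L // i.Ω 0 = Set.univ} => (zdGF3 (Matrix n n ℂ) L 1 len i.1).toGFData) →
      B8.Prop3Printed 4 (L : ℝ) C₂ inp B₀β
        (fun i : {i : ZdIdx 4 L // i.Ω 0 = Set.univ} => (zdGF3 (Matrix n n ℂ) L 1 len i.1).toGFData2) →
      ∃ c₁' : ℝ, 0 < c₁' ∧ 16 * (5 * ((4 : ℕ) : ℝ) * L * inp.B₀ * c₁') ≤ 1 ∧
      ∀ ⦃b' c' : ℝ⦄, 0 ≤ b' → 0 ≤ c' →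
      2 ^ 15 * ((4 : ℝ) + 1) ^ 2 * ((4 : ℝ) + 4) ^ 2 * (L : ℝ) ^ 2 * b' ≤ 1 →
      23040 * (4 : ℝ) ^ 4 * (frameC 4 L + 4) ^ 3 * (c' + curConst 4 L * b' ^ 2) ≤ 1 →
      ∀ ⦃α : ℝ⦄, 0 < α → C0 4 * α ≤ 1 / 3 → 2 * α ≤ c2' 4 L → 11 * (4 : ℝ) ^ 2 * α ≤ 1 / 6 → α + 11 * (4 : ℝ) ^ 2 * α ≤ c₁' →
      b' + 226 * (8 * ((4 : ℝ) + 1) * ((4 : ℝ) + 4)) ^ 2 * b' ^ 2 < α → 4 * ((4 : ℝ) - 1) * (c' + curConst 4 L * b' ^ 2) < α →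
      ∀ ⦃Mc : ℝ⦄, 0 ≤ Mc → (Mc + 1) * (b' + 226 * (8 * ((4 : ℝ) + 1) * ((4 : ℝ) + 4)) ^ 2 * b' ^ 2) ≤ 1 / 2 →
      ∀ (𝒬 : ℕ → Set (Set (Site 4) × ℕ)), (∀ k, ∀ q ∈ 𝒬 k, q.2 ≤ k ∧ ∃ y : Site 4, ∀ z ∈ q.1, (l1 (z - y) : ℝ) ≤ Mc * (L : ℝ) ^ q.2) →
      ∀ ⦃C335 : ℝ⦄, 2 * (Mc + 1) * (b' + 226 * (8 * ((4 : ℝ) + 1) * ((4 : ℝ) + 4)) ^ 2 * b' ^ 2) + 2 * Mc * (2 * (c' + curConst 4 L * b' ^ 2)) +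
        4 * Mc * (1 + 2 * Mc) * (b' + 226 * (8 * ((4 : ℝ) + 1) * ((4 : ℝ) + 4)) ^ 2 * b' ^ 2) ^ 2 < C335 →
      ∀ ⦃ε s₁ b s₂ : ℝ⦄, 0 < ε → ε ≤ r → ε < α → 0 ≤ s₁ → s₁ ≤ r → 0 ≤ b → b ≤ ε / 2 →
      5 * ((4 : ℕ) : ℝ) * L * inp.B₀ * (α + 11 * (4 : ℝ) ^ 2 * α) ≤ s₁ →
      5 * ((4 : ℕ) : ℝ) * L * inp.B₀ * (α + 11 * (4 : ℝ) ^ 2 * α) +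
          2 * (b' + 226 * (8 * ((4 : ℝ) + 1) * ((4 : ℝ) + 4)) ^ 2 * b' ^ 2) * s₁ ≤ s₁ →
      5 * ((4 : ℕ) : ℝ) * L * inp.B₀ * (α + 11 * (4 : ℝ) ^ 2 * α) + 16 * (b' + 226 * (8 * ((4 : ℝ) + 1) * ((4 : ℝ) + 4)) ^ 2 * b' ^ 2) *
          (5 * ((4 : ℕ) : ℝ) * L * inp.B₀ * (α + 11 * (4 : ℝ) ^ 2 * α)) ≤ s₁ →
      5 * ((4 : ℕ) : ℝ) * L * B₀β * (α + 11 * (4 : ℝ) ^ 2 * α) + 8 * (b' + 226 * (8 * ((4 : ℝ) + 1) * ((4 : ℝ) + 4)) ^ 2 * b' ^ 2) *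
          (5 * ((4 : ℕ) : ℝ) * L * inp.B₀ * (α + 11 * (4 : ℝ) ^ 2 * α)) ≤ s₂ →
      ∀ {dom : _root_.Set (Site 4 → Fin 4 → (Matrix n n ℂ)ˣ)},
        LeafH3sup 4 L N ε b' c' dom →
        NE3EnergyRateWCov 4 (sfClass 4 L N ε) L N b g C s₁ s₂ dom := by
  letI : CStarAlgebra (Matrix n n ℂ) := {}
  obtain ⟨r, hr0, hr⟩ := n16_of_leaf (n := n) hL hN
  refine ⟨r, hr0, fun g hg => ?_⟩
  obtain ⟨C, hC0, hC⟩ := hr hg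
  refine ⟨C, hC0, fun C₂ B₁' inp B₀β len hlen hlen1 hB₁' hBB hT4 hP3 => ?_⟩
  -- the two printed thresholds, and the window threshold below them
  obtain ⟨c₁t, hc₁t, hT⟩ := hT4
  obtain ⟨cP, hcP, hP⟩ := hP3
  obtain ⟨c₁', hc₁', hwin⟩ := exists_window_print (d := 4) (L := L) (by norm_num) hL C₂ hc₁t hcP hB₁'
  have hB0 : 0 ≤ 5 * ((4 : ℕ) : ℝ) * L * inp.B₀ := by have := inp.B₀_pos.le; positivity
  have h16 : 16 * (5 * ((4 : ℕ) : ℝ) * L * inp.B₀ * c₁') ≤ 1 := by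
    obtain ⟨-, -, -, h, -⟩ := hwin (c₁' / 2) (c₁' / 2) (by linarith) (by linarith) (by linarith)
    have h' : 16 * (B₁' * c₁') ≤ 1 := by rwa [add_halves] at h
    nlinarith [mul_le_mul_of_nonneg_right hBB hc₁'.le]
  refine ⟨c₁', hc₁', h16, fun b' c' hb' hc' hRb hcF α hα hA3 hA2 hAs hAc hb'α hc'α Mc hMc hMcα 𝒬 h𝒬 C335 hC335 ε s₁ b s₂ hε hεr hεα hs₁
    hs₁r hb hbh hss hgrad hℓ hhol dom h3 => ?_⟩
  exact hC c₁t c₁' B₁' cP C₂ B₀β inp len hlen hlen1 hB₁' hBB h16 hwin hb' hc' hRb hcF hα hA3 hA2 hAs hAc hb'α hc'α hMc hMcα 𝒬 h𝒬 hC335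
    hε hεr hεα hs₁ hs₁r hb hbh hss hgrad hℓ hhol hT hP h3

/-- **N16 · THE MULTI-SCALE β-ROOT FROM NODE N05's THEOREM 4 AND PROPOSITION 3 ON `zdGF3 (M_n(ℂ)) L β len` OVER THE UNIV SUB-INDEX, AND N07's (H3ˢᵘᵖ)**
(`d = 4`, `L ≥ 2`, `N ≥ 1`, ANY `β ∈ [0, 1]` — node N05's residual Hölder exponent, printed «β ≦ β₀ < 1»; repair R-β″) — generation 4's
`N16HolderMSOfLeafTop.n16_holderMS_of_b8LeafRS` with its ONE (uninhabited, §1) hypothesis `B8LeafRS …` REPLACED by the two fields it read: `B8.Thm4Printed B₁′ fam`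
and `B8.Prop3Printed 4 L C₂ inp B₀β fam₂` at `fam := fun i : {i : ZdIdx 4 L // i.Ω 0 = univ} ↦ zdGF3 (M_n ℂ) L β len i.1`; letters `len ≥ 1` on its support,
`len (j•e_μ) = j`, `0 < B₁′`, `5·4·L·B₀ ≤ B₁′`.  Conclusion VERBATIM: `∃ c₁′ > 0` with `16·(5·4·L·B₀)·c₁′ ≤ 1` and file 36 §2's tail (Hölder threshold
`B_h·s + 10·α_{b′}·B·s ≤ s₂`), ending in `LeafH3sup 4 L N ε b′ c′ dom → CovRootHolderMS 4 (sfClass 4 L N ε) L N b g C s₁ s₂ β dom`.  N16 ∕ NE3 NOT proved: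
Theorem 4 ∕ Proposition 3 on the `ℤ⁴` carriers are node N05's theorems, (H3ˢᵘᵖ) is N07's. [cite: Balaban1985RegularSpaces, Thm 4 p.88, Prop. 3 p.87, (1.36) p.82] [folklore] -/
theorem n16_holderMS_of_leafTP [Nonempty n] {L N : ℕ} (hL : 2 ≤ L) (hN : 1 ≤ N) :
    letI : CStarAlgebra (Matrix n n ℂ) := {}
    ∃ r : ℝ, 0 < r ∧ ∀ ⦃g : ℝ⦄, 0 < g → ∃ C : ℝ, 0 ≤ C ∧
      ∀ ⦃β : ℝ⦄, 0 ≤ β → β ≤ 1 → ∀ (C₂ B₁' : ℝ) (inp : B8.B9Inputs) (B₀β : ℝ) (len : Site 4 → ℝ),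
      (∀ v : Site 4, 0 < len v → 1 ≤ len v) → (∀ (μ : Fin 4) (j : ℕ), len (j • e μ) = j) → 0 < B₁' → 5 * ((4 : ℕ) : ℝ) * L * inp.B₀ ≤ B₁' →
      B8.Thm4Printed B₁' (fun i : {i : ZdIdx 4 L // i.Ω 0 = Set.univ} => (zdGF3 (Matrix n n ℂ) L β len i.1).toGFData) →
      B8.Prop3Printed 4 (L : ℝ) C₂ inp B₀β
        (fun i : {i : ZdIdx 4 L // i.Ω 0 = Set.univ} => (zdGF3 (Matrix n n ℂ) L β len i.1).toGFData2) →
      ∃ c₁' : ℝ, 0 < c₁' ∧ 16 * (5 * ((4 : ℕ) : ℝ) * L * inp.B₀ * c₁') ≤ 1 ∧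
      ∀ ⦃b' c' : ℝ⦄, 0 ≤ b' → 0 ≤ c' →
      2 ^ 15 * ((4 : ℝ) + 1) ^ 2 * ((4 : ℝ) + 4) ^ 2 * (L : ℝ) ^ 2 * b' ≤ 1 →
      23040 * (4 : ℝ) ^ 4 * (frameC 4 L + 4) ^ 3 * (c' + curConst 4 L * b' ^ 2) ≤ 1 →
      ∀ ⦃α : ℝ⦄, 0 < α → C0 4 * α ≤ 1 / 3 → 2 * α ≤ c2' 4 L → 11 * (4 : ℝ) ^ 2 * α ≤ 1 / 6 → α + 11 * (4 : ℝ) ^ 2 * α ≤ c₁' →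
      b' + 226 * (8 * ((4 : ℝ) + 1) * ((4 : ℝ) + 4)) ^ 2 * b' ^ 2 < α → 4 * ((4 : ℝ) - 1) * (c' + curConst 4 L * b' ^ 2) < α →
      ∀ ⦃Mc : ℝ⦄, 0 ≤ Mc → (Mc + 1) * (b' + 226 * (8 * ((4 : ℝ) + 1) * ((4 : ℝ) + 4)) ^ 2 * b' ^ 2) ≤ 1 / 2 →
      ∀ (𝒬 : ℕ → Set (Set (Site 4) × ℕ)), (∀ k, ∀ q ∈ 𝒬 k, q.2 ≤ k ∧ ∃ y : Site 4, ∀ z ∈ q.1, (l1 (z - y) : ℝ) ≤ Mc * (L : ℝ) ^ q.2) →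
      ∀ ⦃C335 : ℝ⦄, 2 * (Mc + 1) * (b' + 226 * (8 * ((4 : ℝ) + 1) * ((4 : ℝ) + 4)) ^ 2 * b' ^ 2) + 2 * Mc * (2 * (c' + curConst 4 L * b' ^ 2)) +
        4 * Mc * (1 + 2 * Mc) * (b' + 226 * (8 * ((4 : ℝ) + 1) * ((4 : ℝ) + 4)) ^ 2 * b' ^ 2) ^ 2 < C335 →
      ∀ ⦃ε s₁ b s₂ : ℝ⦄, 0 < ε → ε ≤ r → ε < α → 0 ≤ s₁ → s₁ ≤ r → 0 ≤ b → b ≤ ε / 2 →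
      5 * ((4 : ℕ) : ℝ) * L * inp.B₀ * (α + 11 * (4 : ℝ) ^ 2 * α) ≤ s₁ →
      5 * ((4 : ℕ) : ℝ) * L * inp.B₀ * (α + 11 * (4 : ℝ) ^ 2 * α) +
          2 * (b' + 226 * (8 * ((4 : ℝ) + 1) * ((4 : ℝ) + 4)) ^ 2 * b' ^ 2) * s₁ ≤ s₁ →
      5 * ((4 : ℕ) : ℝ) * L * inp.B₀ * (α + 11 * (4 : ℝ) ^ 2 * α) + 16 * (b' + 226 * (8 * ((4 : ℝ) + 1) * ((4 : ℝ) + 4)) ^ 2 * b' ^ 2) *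
          (5 * ((4 : ℕ) : ℝ) * L * inp.B₀ * (α + 11 * (4 : ℝ) ^ 2 * α)) ≤ s₁ →
      5 * ((4 : ℕ) : ℝ) * L * B₀β * (α + 11 * (4 : ℝ) ^ 2 * α) + 10 * (b' + 226 * (8 * ((4 : ℝ) + 1) * ((4 : ℝ) + 4)) ^ 2 * b' ^ 2) *
          (5 * ((4 : ℕ) : ℝ) * L * inp.B₀ * (α + 11 * (4 : ℝ) ^ 2 * α)) ≤ s₂ →
      ∀ {dom : _root_.Set (Site 4 → Fin 4 → (Matrix n n ℂ)ˣ)},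
        LeafH3sup 4 L N ε b' c' dom →
        CovRootHolderMS 4 (sfClass 4 L N ε) L N b g C s₁ s₂ β dom := by
  letI : CStarAlgebra (Matrix n n ℂ) := {}
  obtain ⟨r, hr0, hr⟩ := n16_holderMS_of_leaf (n := n) hL hN
  refine ⟨r, hr0, fun g hg => ?_⟩
  obtain ⟨C, hC0, hC⟩ := hr hg
  refine ⟨C, hC0, fun β hβ0 hβ1 C₂ B₁' inp B₀β len hlen hlen1 hB₁' hBB hT4 hP3 => ?_⟩
  -- the two printed thresholds, and the window threshold below them
  obtain ⟨c₁t, hc₁t, hT⟩ := hT4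
  obtain ⟨cP, hcP, hP⟩ := hP3
  obtain ⟨c₁', hc₁', hwin⟩ := exists_window_print (d := 4) (L := L) (by norm_num) hL C₂ hc₁t hcP hB₁'
  have hB0 : 0 ≤ 5 * ((4 : ℕ) : ℝ) * L * inp.B₀ := by have := inp.B₀_pos.le; positivity
  have h16 : 16 * (5 * ((4 : ℕ) : ℝ) * L * inp.B₀ * c₁') ≤ 1 := by
    obtain ⟨-, -, -, h, -⟩ := hwin (c₁' / 2) (c₁' / 2) (by linarith) (by linarith) (by linarith)
    have h' : 16 * (B₁' * c₁') ≤ 1 := by rwa [add_halves] at h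
    nlinarith [mul_le_mul_of_nonneg_right hBB hc₁'.le]
  refine ⟨c₁', hc₁', h16, fun b' c' hb' hc' hRb hcF α hα hA3 hA2 hAs hAc hb'α hc'α Mc hMc hMcα 𝒬 h𝒬 C335 hC335 ε s₁ b s₂ hε hεr hεα hs₁
    hs₁r hb hbh hss hgrad hℓ hhol dom h3 => ?_⟩
  exact hC c₁t c₁' B₁' cP C₂ B₀β inp len hlen hlen1 hB₁' hBB h16 hwin hb' hc' hRb hcF hα hA3 hA2 hAs hAc hb'α hc'α hMc hMcα 𝒬 h𝒬 hC335
    hε hεr hεα hs₁ hs₁r hb hbh hss hgrad hℓ hhol hβ0 hβ1 hT hP h3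

/-- ★ **THE N05 → N16 EDGE AT PRINT's ℓ¹ LENGTH, RE-CUT AT THEOREM 4 ∕ PROPOSITION 3** (`d = 4`, `L ≥ 2`, `N ≥ 1`, any `β ∈ [0,1]`): `n16_holderMS_of_leafTP` at
`len := B9Eq340HolderZd.l1Len`, the two length letters discharged by `one_le_l1Len` and `N16HolderMSOfLeafL1.l1Len_nsmul_e` — generation 4's ★
`n16_holderMS_of_b8LeafRS_l1Len` with its uninhabited leaf hypothesis replaced by `B8.Thm4Printed B₁′ fam ∧ B8.Prop3Printed 4 L C₂ inp B₀β fam₂` on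
`fam := fun i : {i // i.Ω 0 = univ} ↦ zdGF3 (M_n ℂ) L β l1Len i.1`.  N16 ∕ NE3 NOT proved: Theorem 4 ∕ Proposition 3 there are node N05's theorems, (H3ˢᵘᵖ) is N07's.
[cite: Balaban1985RegularSpaces, Thm 4 p.88, Prop. 3 p.87, (1.36) p.82; Balaban1985BackgroundPropagators, (3.40) p.397] [folklore] -/
theorem n16_holderMS_of_leafTP_l1Len [Nonempty n] {L N : ℕ} (hL : 2 ≤ L) (hN : 1 ≤ N) :
    letI : CStarAlgebra (Matrix n n ℂ) := {}
    ∃ r : ℝ, 0 < r ∧ ∀ ⦃g : ℝ⦄, 0 < g → ∃ C : ℝ, 0 ≤ C ∧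
      ∀ ⦃β : ℝ⦄, 0 ≤ β → β ≤ 1 → ∀ (C₂ B₁' : ℝ) (inp : B8.B9Inputs) (B₀β : ℝ),
      0 < B₁' → 5 * ((4 : ℕ) : ℝ) * L * inp.B₀ ≤ B₁' →
      B8.Thm4Printed B₁' (fun i : {i : ZdIdx 4 L // i.Ω 0 = Set.univ} => (zdGF3 (Matrix n n ℂ) L β l1Len i.1).toGFData) →
      B8.Prop3Printed 4 (L : ℝ) C₂ inp B₀β
        (fun i : {i : ZdIdx 4 L // i.Ω 0 = Set.univ} => (zdGF3 (Matrix n n ℂ) L β l1Len i.1).toGFData2) →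
      ∃ c₁' : ℝ, 0 < c₁' ∧ 16 * (5 * ((4 : ℕ) : ℝ) * L * inp.B₀ * c₁') ≤ 1 ∧
      ∀ ⦃b' c' : ℝ⦄, 0 ≤ b' → 0 ≤ c' →
      2 ^ 15 * ((4 : ℝ) + 1) ^ 2 * ((4 : ℝ) + 4) ^ 2 * (L : ℝ) ^ 2 * b' ≤ 1 →
      23040 * (4 : ℝ) ^ 4 * (frameC 4 L + 4) ^ 3 * (c' + curConst 4 L * b' ^ 2) ≤ 1 →
      ∀ ⦃α : ℝ⦄, 0 < α → C0 4 * α ≤ 1 / 3 → 2 * α ≤ c2' 4 L → 11 * (4 : ℝ) ^ 2 * α ≤ 1 / 6 → α + 11 * (4 : ℝ) ^ 2 * α ≤ c₁' →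
      b' + 226 * (8 * ((4 : ℝ) + 1) * ((4 : ℝ) + 4)) ^ 2 * b' ^ 2 < α → 4 * ((4 : ℝ) - 1) * (c' + curConst 4 L * b' ^ 2) < α →
      ∀ ⦃Mc : ℝ⦄, 0 ≤ Mc → (Mc + 1) * (b' + 226 * (8 * ((4 : ℝ) + 1) * ((4 : ℝ) + 4)) ^ 2 * b' ^ 2) ≤ 1 / 2 →
      ∀ (𝒬 : ℕ → Set (Set (Site 4) × ℕ)), (∀ k, ∀ q ∈ 𝒬 k, q.2 ≤ k ∧ ∃ y : Site 4, ∀ z ∈ q.1, (l1 (z - y) : ℝ) ≤ Mc * (L : ℝ) ^ q.2) →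
      ∀ ⦃C335 : ℝ⦄, 2 * (Mc + 1) * (b' + 226 * (8 * ((4 : ℝ) + 1) * ((4 : ℝ) + 4)) ^ 2 * b' ^ 2) + 2 * Mc * (2 * (c' + curConst 4 L * b' ^ 2)) +
        4 * Mc * (1 + 2 * Mc) * (b' + 226 * (8 * ((4 : ℝ) + 1) * ((4 : ℝ) + 4)) ^ 2 * b' ^ 2) ^ 2 < C335 →
      ∀ ⦃ε s₁ b s₂ : ℝ⦄, 0 < ε → ε ≤ r → ε < α → 0 ≤ s₁ → s₁ ≤ r → 0 ≤ b → b ≤ ε / 2 →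
      5 * ((4 : ℕ) : ℝ) * L * inp.B₀ * (α + 11 * (4 : ℝ) ^ 2 * α) ≤ s₁ →
      5 * ((4 : ℕ) : ℝ) * L * inp.B₀ * (α + 11 * (4 : ℝ) ^ 2 * α) +
          2 * (b' + 226 * (8 * ((4 : ℝ) + 1) * ((4 : ℝ) + 4)) ^ 2 * b' ^ 2) * s₁ ≤ s₁ →
      5 * ((4 : ℕ) : ℝ) * L * inp.B₀ * (α + 11 * (4 : ℝ) ^ 2 * α) + 16 * (b' + 226 * (8 * ((4 : ℝ) + 1) * ((4 : ℝ) + 4)) ^ 2 * b' ^ 2) *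
          (5 * ((4 : ℕ) : ℝ) * L * inp.B₀ * (α + 11 * (4 : ℝ) ^ 2 * α)) ≤ s₁ →
      5 * ((4 : ℕ) : ℝ) * L * B₀β * (α + 11 * (4 : ℝ) ^ 2 * α) + 10 * (b' + 226 * (8 * ((4 : ℝ) + 1) * ((4 : ℝ) + 4)) ^ 2 * b' ^ 2) *
          (5 * ((4 : ℕ) : ℝ) * L * inp.B₀ * (α + 11 * (4 : ℝ) ^ 2 * α)) ≤ s₂ →
      ∀ {dom : _root_.Set (Site 4 → Fin 4 → (Matrix n n ℂ)ˣ)},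
        LeafH3sup 4 L N ε b' c' dom →
        CovRootHolderMS 4 (sfClass 4 L N ε) L N b g C s₁ s₂ β dom := by
  letI : CStarAlgebra (Matrix n n ℂ) := {}
  obtain ⟨r, hr0, hr⟩ := n16_holderMS_of_leafTP (n := n) hL hN
  refine ⟨r, hr0, fun g hg => ?_⟩
  obtain ⟨C, hC0, hC⟩ := hr hg
  exact ⟨C, hC0, fun β hβ0 hβ1 C₂ B₁' inp B₀β hB₁' hBB hT4 hP3 =>
    hC hβ0 hβ1 C₂ B₁' inp B₀β l1Len (fun v hv => one_le_l1Len hv) l1Len_nsmul_e hB₁' hBB hT4 hP3⟩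

end Matrices

end

end Summit.QuantumFields.YangMills.BalabanUVNodes.N16OfLeafTP
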